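import Literature.MathematicalPhysics.QuantumFieldTheory.Balaban1983to89.B9SectBCodedChainGlob
import Literature.MathematicalPhysics.QuantumFieldTheory.Balaban1983to89.B9SectBL2SecondOrderY
import Literature.MathematicalPhysics.QuantumFieldTheory.Balaban1983to89.B9SectBStepFamilyTransferPos

/-!
# `Balaban1983to89.B9SectBCodedChainL2` — the coded-carrier chain with the AUGMENTED `L²` MEMBER (`KSC₃`): the Theorem-3.1–3.3 blocks of `KSC₃` at a
# base from `KSC₂`'s (hin of the (3.46) member), and `KSC₂`'s at a product from `KSC₃`'s (hout of the (3.46) member), at one member and on a subfamily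

T. Bałaban, *Propagators for lattice gauge theories in a background field*, Commun. Math. Phys. **99** (1985) 389–434
[`Balaban1985BackgroundPropagators`, "B9"]; [4] = T. Bałaban, *Propagators and renormalization transformations for lattice gauge
theories. II*, Commun. Math. Phys. **96** (1984) 223–250 [`Balaban1984PropagatorsII`].

statement-level skeleton of published theorems with citation tags; proofs where landed; nothing here is a claim about the
Yang–Mills mass gap

THE PRINTED LOCI.  Theorems 3.1–3.3 (3.42)–(3.48) pp. 397–399; Theorem 3.4 p. 400 and Sect. B pp. 400–407; p. 398 first remark («we may always replace
∇_U by ∇*_U, and vice versa»); p. 403 l.1–9 («all the statements (3.42)–(3.47) of Theorem 3.1 for the operator G′(U′U), of course with different constants»);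
p. 404 after (3.69) (the plaquette smallness of the configurations in play); [4] Lemma 2.1 p. 234, Prop. 2.6 p. 247.

WHY THIS FILE (pub-ymgap N06 row 13, seat dag-n06-c gen 9, (O4) per-member programme, `L²` member).  `B9SectBCodedChainGlob` runs the Sect.-B step on the
coded carrier with `KSC₂` (the (3.42) member augmented, the (3.47) member silent at products).  The (3.46) member is augmented in `KSC₃`
(`B9SectBL2DictionaryY`): every orientation pattern of the six words, letters at the base, operator at the evaluated configuration — which makes the frames'
`L²` fields inhabitable (`l2Frame₂CodedOn`).  The price is paid at the two ends, and `B9SectBL2SecondOrderY` pays it modulo ONE displayed letter law, the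
plaquette smallness `PlaqLawY c_P U` of the `G`-valued base: hin (`l2Block_KSC₃_base_of_record`: the record's (3.46) block at the base ⇒ `KSC₃`'s) and hout
(`l2Block_record_at_W_of_KSC₃'`: `KSC₃`'s block at the product ⇒ the record's at `U′U`).  §1 turns these into the Theorem-3.1–3.3 BLOCKS the chain speaks:
`thms_KSC₃_base_of_KSC₂` and `thms_KSC₂_prod_of_KSC₃` (the other members of `KSC₃` are `KSC₂`'s; constants `max`, rates `min`); §2 runs them on a subfamily
with the thresholds of Lemma 2.1 of [4] (`exists_d261` at exponent `1/12`) and of the scale transfers (`scaleTransfer6_window_geo9Y`): `hin_KSC₃_on` (from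
`hin_KSC₂_on`) and `hout_KSC₃_on` (into `hout_KSC₂_on`), the plaquette law carried as the displayed hypothesis `hplaq` on the (3.35)-regular bases of the
subfamily.  What is NOT here: the frames' own step for `KSC₃` (its `L²` frame is `B9SectBL2DictionaryY.l2Frame₂CodedOn`; the Hölder and `C⁻¹` members of the
(O4) programme are separate seats' items), hence no `sectBStepPrinted_on_of_KSC₃` yet.
Value = bookkeeping of the coded-carrier chain for one member; NOT summit progress; N06 is not discharged by this file.
-/

noncomputable section

namespace Literature.MathematicalPhysics.QuantumFieldTheory.Balaban1983to89.B9SectBCodedChainL2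

open Literature.MathematicalPhysics.QuantumFieldTheory.Balaban1983to89
open Literature.MathematicalPhysics.QuantumFieldTheory.Balaban1983to89.B6KLevelCensusIndexV1 (KIdx kGeo)
open Literature.MathematicalPhysics.QuantumFieldTheory.Balaban1983to89.B6Ineq2142KLevelV1 (β)
open Literature.MathematicalPhysics.QuantumFieldTheory.Balaban1983to89.B6RandomWalk (Ineq261)
open Literature.MathematicalPhysics.QuantumFieldTheory.Balaban1983to89.B9Thm34Ext (toB6)
open Literature.MathematicalPhysics.QuantumFieldTheory.Balaban1983to89.B9Ineq347 (ScaleTransfer)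
open Literature.MathematicalPhysics.QuantumFieldTheory.Balaban1983to89.B9FromB6 (EBlock GlobBlock L2Block pref6_nonneg)
open Literature.MathematicalPhysics.QuantumFieldTheory.Balaban1983to89.B9Eq39Adjoint (fluct)
open Literature.MathematicalPhysics.QuantumFieldTheory.Balaban1983to89.B9SectBCodedCarrier (CCfg Coding pullK pullS pullAn sectBStepPrinted_of_coded)
open Literature.MathematicalPhysics.QuantumFieldTheory.Balaban1983to89.B9SectBStepFamilyTransferPos (sectBStepPrinted_of_family_pos)
open Literature.MathematicalPhysics.QuantumFieldTheory.Balaban1983to89.B9Eq360DeltaPrimeAY (AfldY mulY)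
open Literature.MathematicalPhysics.QuantumFieldTheory.Balaban1983to89.B9PinMembersKLevelV1 (MemberY geo9Y bg9Y)
open Literature.MathematicalPhysics.QuantumFieldTheory.Balaban1983to89.B9SectBGpLettersY (GVal blkC)
open Literature.MathematicalPhysics.QuantumFieldTheory.Balaban1983to89.B9SectBGpFrameCodedY (codingYx CplxLettersY exists_d261)
open Literature.MathematicalPhysics.QuantumFieldTheory.Balaban1983to89.B9SectBGpReadingsY (KSC)
open Literature.MathematicalPhysics.QuantumFieldTheory.Balaban1983to89.B9SectBGpTransferInY (KSC_members_base)
open Literature.MathematicalPhysics.QuantumFieldTheory.Balaban1983to89.B9SectBGpTransferOutY (KSC_members_prod ineq342_346_347_weaken ineq343_345_antitone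
  kernelFamilyS_members_nonneg)
open Literature.MathematicalPhysics.QuantumFieldTheory.Balaban1983to89.B9SectBCodedChainGlob (KSC₂ hin_KSC₂_on hout_KSC₂_on)
open Literature.MathematicalPhysics.QuantumFieldTheory.Balaban1983to89.B9SectBCodedChainOnSubfamily (hin_KSC_on)
open Literature.MathematicalPhysics.QuantumFieldTheory.Balaban1983to89.B9SectBL2DictionaryY (KSC₃ KSC₃_l2)
open Literature.MathematicalPhysics.QuantumFieldTheory.Balaban1983to89.B9SectBL2SecondOrderY (PlaqLawY l2Block_KSC₃_base_of_record l2Block_record_at_W_of_KSC₃'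
  convConst2L2 convConst2L2_nonneg cross2ConstL2 cross2ConstL2_nonneg)
open Literature.MathematicalPhysics.QuantumFieldTheory.Balaban1983to89.B9SectBL2TransferInY (crossConstL2 crossConstL2_nonneg)
open Literature.MathematicalPhysics.QuantumFieldTheory.Balaban1983to89.B9RWSums347DefiniteFacesWindow (scaleTransfer6_window_geo9Y scaleTransfer_congr)
open Literature.MathematicalPhysics.QuantumFieldTheory.Balaban1983to89.B9GeoLemma21KLevelV1 (geo9Y_len_pos)
open Literature.MathematicalPhysics.QuantumFieldTheory.Balaban1983to89.B9GeoNormsKLevelV1 (geo9K_dist_nonneg)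
open Literature.MathematicalPhysics.QuantumFieldTheory.Balaban1983to89.Node00 (SiteY BlkY IBondY CfgY SiteParY kernelFamilyS GpY)

variable {d ℓ : ℕ} {hd : 1 ≤ d + 1} {hL : Odd (ℓ + 1) ∧ 1 < ℓ + 1} {b₀ b₁ : ℝ} {Mstar : ℕ}
variable {𝔸 : Type} [NormedRing 𝔸] [NormedAlgebra ℂ 𝔸] [CompleteSpace 𝔸] [NormOneClass 𝔸] [FiniteDimensional ℝ 𝔸]

/-! ## §1  At one member: the Theorem-3.1–3.3 blocks of `KSC₃` ↔ `KSC₂` with the `L²` member converted -/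

section Member

variable (G : Subgroup 𝔸ˣ) (x : MemberY d ℓ hd hL b₀ b₁ Mstar) (par : SiteParY 𝔸 x.toKIdx)
  (C37 C38 : ℝ → CfgY 𝔸 x.toKIdx → AfldY 𝔸 x.toKIdx → Prop)

omit [NormOneClass 𝔸] [FiniteDimensional ℝ 𝔸] in
/-- a (3.46) block with its constant raised and its rate lowered. [cite: Balaban1985BackgroundPropagators, (3.46) p.398, bookkeeping] -/
theorem l2Block_weaken {Bg : B9.Backgrounds} (K : B9.KernelFamily (geo9Y x) Bg) {B B' δ δ' : ℝ} {c : Bg.Cfg}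
    (hB : 0 ≤ B) (hle : B ≤ B') (hδ : δ' ≤ δ) (h : L2Block K B δ c) : L2Block K B' δ' c := by
  intro n lam hh y y' hc hs
  refine (h n lam hh y y' hc hs).trans ?_
  have h1 : 0 ≤ B9.pref6 ((geo9Y x).len y) n := pref6_nonneg (geo9Y_len_pos x y).le n
  have h2 : 0 ≤ (geo9Y x).cutSup hh := B9GeoNormsKLevelV1.geo9K_cutSup_nonneg x.toKIdx hh
  have h3 : 0 ≤ (geo9Y x).l2Norm lam := B9GeoNormsKLevelV1.geo9K_l2Norm_nonneg x.toKIdx lam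
  have h4 : Real.exp (-(δ * (geo9Y x).dist y y')) ≤ Real.exp (-(δ' * (geo9Y x).dist y y')) :=
    Real.exp_le_exp.2 (by have hD : 0 ≤ (geo9Y x).dist y y' := geo9K_dist_nonneg x.toKIdx y y'; nlinarith [mul_le_mul_of_nonneg_right hδ hD])
  have h5 := (Real.exp_pos (-(δ * (geo9Y x).dist y y'))).le
  have h6 : 0 ≤ B' * B9.pref6 ((geo9Y x).len y) n := mul_nonneg (hB.trans hle) h1
  gcongr

omit [NormOneClass 𝔸] [FiniteDimensional ℝ 𝔸] in
/-- ★ **`KSC₃`'s THEOREM-3.1–3.3 BLOCK AT A BASE FROM `KSC₂`'s AND THE CONVERTED (3.46) BLOCK** (hin of the `L²` member): the (3.42)–(3.45) and (3.47)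
members of `KSC₃` are `KSC₂`'s; the augmented (3.46) member is supplied separately (`B9SectBL2SecondOrderY.l2Block_KSC₃_base_of_record`); constants
`max B₀ B′`, rate `min δ₀ δ′`. [cite: Balaban1985BackgroundPropagators, Thms 3.1–3.3 (3.42)–(3.48) pp.397–399, bookkeeping] -/
theorem thms_KSC₃_base_of_KSC₂ (dC : ℕ) (GA : B9.KernelFamily (geo9Y x) (codingYx G x C37 C38).bg) (Cinv : B9.SiteKernel (geo9Y x) (codingYx G x C37 C38).bg)
    {B₀ δ₀ : ℝ} {Bβ Bε : ℝ → ℝ} {Bεβ : ℝ → ℝ → ℝ} {B₁ δ₁ : ℝ} {U : CfgY 𝔸 x.toKIdx} (hB₀ : 0 ≤ B₀)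
    (hGA1 : ∀ lam β' ζ, 0 ≤ GA.h1 (.base U) lam β' ζ) (hGA4 : ∀ lam y, 0 ≤ GA.e4 (.base U) lam y) (hGA2 : ∀ lam β' ζ, 0 ≤ GA.h2 (.base U) lam β' ζ)
    (h : B9.Thms31to33IneqAt dC (KSC₂ G x par C37 C38) GA Cinv B₀ δ₀ Bβ Bε Bεβ B₁ δ₁ (.base U))
    {B' δ' : ℝ} (hB' : 0 ≤ B') (hL : L2Block (KSC₃ G x par C37 C38) B' δ' (.base U)) :
    B9.Thms31to33IneqAt dC (KSC₃ G x par C37 C38) GA Cinv (max B₀ B') (min δ₀ δ') Bβ Bε Bεβ B₁ δ₁ (.base U) := by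
  obtain ⟨⟨h42, h43⟩, hC, ⟨g42, g43⟩⟩ := h
  have h42' := ineq342_346_347_weaken G x C37 C38 (KSC₂ G x par C37 C38) hB₀ (le_max_left B₀ B') (min_le_left δ₀ δ') h42
  have hL' := l2Block_weaken x (KSC₃ G x par C37 C38) hB' (le_max_right B₀ B') (min_le_right δ₀ δ') hL
  have mK := KSC_members_base G x par C37 C38 U
  have hnn := kernelFamilyS_members_nonneg x par (B := bg9Y 𝔸 G x) (fun U => U) (GpY x.toKIdx par) U
  have hP1 : ∀ lam β' ζ, 0 ≤ (KSC₃ G x par C37 C38).h1 (.base U) lam β' ζ := fun lam β' ζ => by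
    show 0 ≤ (KSC G x par C37 C38).h1 (.base U) lam β' ζ; rw [mK.1]; exact hnn.1 lam β' ζ
  have hP4 : ∀ lam y, 0 ≤ (KSC₃ G x par C37 C38).e4 (.base U) lam y := fun lam y => by
    show 0 ≤ (KSC G x par C37 C38).e4 (.base U) lam y; rw [mK.2.1]; exact hnn.2.1 lam y
  have hP2 : ∀ lam β' ζ, 0 ≤ (KSC₃ G x par C37 C38).h2 (.base U) lam β' ζ := fun lam β' ζ => by
    show 0 ≤ (KSC G x par C37 C38).h2 (.base U) lam β' ζ; rw [mK.2.2.1]; exact hnn.2.2 lam β' ζ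
  have h43' : B9.Ineq343_345 (KSC₃ G x par C37 C38) Bβ Bε Bεβ δ₀ (.base U) := h43
  refine ⟨⟨⟨fun n lam y y' hs => h42'.1 n lam y y' hs, fun n lam hh y y' hc hs => hL' n lam hh y y' hc hs, fun n lam γ h4 h4' => h42'.2.2 n lam γ h4 h4'⟩,
    ineq343_345_antitone G x C37 C38 _ hP1 hP4 hP2 (min_le_left δ₀ δ') Bβ Bε Bεβ h43'⟩, hC,
    ⟨ineq342_346_347_weaken G x C37 C38 GA hB₀ (le_max_left _ _) (min_le_left _ _) g42,
      ineq343_345_antitone G x C37 C38 GA hGA1 hGA4 hGA2 (min_le_left δ₀ δ') Bβ Bε Bεβ g43⟩⟩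

omit [NormOneClass 𝔸] [FiniteDimensional ℝ 𝔸] in
/-- ★ **`KSC₂`'s THEOREM-3.1–3.3 BLOCK AT A PRODUCT FROM `KSC₃`'s AND THE RECORD's CONVERTED (3.46) BLOCK AT `W = U′U`** (hout of the `L²` member): `KSC₂`'s
(3.46) member at the product IS the record's at `W` (`KSC_members_prod`), supplied by `B9SectBL2SecondOrderY.l2Block_record_at_W_of_KSC₃'`; the other members
are `KSC₃`'s; constants `max B₀ B″`, rate `min δ₀ δ″`. [cite: Balaban1985BackgroundPropagators, Thms 3.1–3.3 (3.42)–(3.48) pp.397–399, p.403 l.1–9, bookkeeping] -/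
theorem thms_KSC₂_prod_of_KSC₃ (dC : ℕ) (GA : B9.KernelFamily (geo9Y x) (codingYx G x C37 C38).bg) (Cinv : B9.SiteKernel (geo9Y x) (codingYx G x C37 C38).bg)
    {B₀ δ₀ : ℝ} {Bβ Bε : ℝ → ℝ} {Bεβ : ℝ → ℝ → ℝ} {B₁ δ₁ : ℝ} {U : CfgY 𝔸 x.toKIdx} {a : AfldY 𝔸 x.toKIdx} (hB₀ : 0 ≤ B₀)
    (hGA1 : ∀ lam β' ζ, 0 ≤ GA.h1 (.prod U a) lam β' ζ) (hGA4 : ∀ lam y, 0 ≤ GA.e4 (.prod U a) lam y) (hGA2 : ∀ lam β' ζ, 0 ≤ GA.h2 (.prod U a) lam β' ζ)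
    (h : B9.Thms31to33IneqAt dC (KSC₃ G x par C37 C38) GA Cinv B₀ δ₀ Bβ Bε Bεβ B₁ δ₁ (.prod U a))
    {B'' δ'' : ℝ} (hB'' : 0 ≤ B'')
    (hconv : L2Block (kernelFamilyS x.toKIdx (bg9Y 𝔸 G x) (fun U => U) (GpY x.toKIdx par) par) B'' δ'' (mulY x.toKIdx (fluct (kGeo x.toKIdx).eta a) U)) :
    B9.Thms31to33IneqAt dC (KSC₂ G x par C37 C38) GA Cinv (max B₀ B'') (min δ₀ δ'') Bβ Bε Bεβ B₁ δ₁ (.prod U a) := by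
  obtain ⟨⟨h42, h43⟩, hC, ⟨g42, g43⟩⟩ := h
  have h42' := ineq342_346_347_weaken G x C37 C38 (KSC₃ G x par C37 C38) hB₀ (le_max_left B₀ B'') (min_le_left δ₀ δ'') h42
  have mK := KSC_members_prod G x par C37 C38 U a
  have hnn := kernelFamilyS_members_nonneg x par (B := bg9Y 𝔸 G x) (fun U => U) (GpY x.toKIdx par) (mulY x.toKIdx (fluct (kGeo x.toKIdx).eta a) U)
  have hP1 : ∀ lam β' ζ, 0 ≤ (KSC₂ G x par C37 C38).h1 (.prod U a) lam β' ζ := fun lam β' ζ => by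
    show 0 ≤ (KSC G x par C37 C38).h1 (.prod U a) lam β' ζ; rw [mK.1]; exact hnn.1 lam β' ζ
  have hP4 : ∀ lam y, 0 ≤ (KSC₂ G x par C37 C38).e4 (.prod U a) lam y := fun lam y => by
    show 0 ≤ (KSC G x par C37 C38).e4 (.prod U a) lam y; rw [mK.2.1]; exact hnn.2.1 lam y
  have hP2 : ∀ lam β' ζ, 0 ≤ (KSC₂ G x par C37 C38).h2 (.prod U a) lam β' ζ := fun lam β' ζ => by
    show 0 ≤ (KSC G x par C37 C38).h2 (.prod U a) lam β' ζ; rw [mK.2.2.1]; exact hnn.2.2 lam β' ζ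
  have h43' : B9.Ineq343_345 (KSC₂ G x par C37 C38) Bβ Bε Bεβ δ₀ (.prod U a) := h43
  -- the record's converted (3.46) block at `W`, read as `KSC₂`'s member at the product, and weakened
  have hLK : L2Block (KSC₂ G x par C37 C38) B'' δ'' (.prod U a) := by
    intro n lam hh y y' hc hs
    show (KSC G x par C37 C38).l2 n (.prod U a) lam hh ≤ _
    rw [mK.2.2.2.1 n]
    exact hconv n lam hh y y' hc hs
  have hL' := l2Block_weaken x (KSC₂ G x par C37 C38) hB'' (le_max_right B₀ B'') (min_le_right δ₀ δ'') hLK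
  refine ⟨⟨⟨fun n lam y y' hs => h42'.1 n lam y y' hs, fun n lam hh y y' hc hs => hL' n lam hh y y' hc hs, fun n lam γ h4 h4' => h42'.2.2 n lam γ h4 h4'⟩,
    ineq343_345_antitone G x C37 C38 _ hP1 hP4 hP2 (min_le_left δ₀ δ'') Bβ Bε Bεβ h43'⟩, hC,
    ⟨ineq342_346_347_weaken G x C37 C38 GA hB₀ (le_max_left _ _) (min_le_left _ _) g42,
      ineq343_345_antitone G x C37 C38 GA hGA1 hGA4 hGA2 (min_le_left δ₀ δ'') Bβ Bε Bεβ g43⟩⟩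

omit [NormOneClass 𝔸] [FiniteDimensional ℝ 𝔸] in
/-- the Theorem-3.1–3.3 block is monotone in the constant `B₀` (no sign needed). [cite: Balaban1985BackgroundPropagators, Thms 3.1–3.3 pp.397–399, bookkeeping] -/
theorem thms_mono_B₀ (dC : ℕ) (K GA : B9.KernelFamily (geo9Y x) (codingYx G x C37 C38).bg) (Cinv : B9.SiteKernel (geo9Y x) (codingYx G x C37 C38).bg)
    {B₀ B₀' δ₀ : ℝ} {Bβ Bε : ℝ → ℝ} {Bεβ : ℝ → ℝ → ℝ} {B₁ δ₁ : ℝ} {c : (codingYx G x C37 C38).bg.Cfg} (hle : B₀ ≤ B₀')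
    (h : B9.Thms31to33IneqAt dC K GA Cinv B₀ δ₀ Bβ Bε Bεβ B₁ δ₁ c) : B9.Thms31to33IneqAt dC K GA Cinv B₀' δ₀ Bβ Bε Bεβ B₁ δ₁ c := by
  obtain ⟨⟨h42, h43⟩, hC, ⟨g42, g43⟩⟩ := h
  exact ⟨⟨B9SectBGpTransferInY.ineq342_346_347_mono G x C37 C38 K hle h42, h43⟩, hC, ⟨B9SectBGpTransferInY.ineq342_346_347_mono G x C37 C38 GA hle g42, g43⟩⟩

omit [NormOneClass 𝔸] [FiniteDimensional ℝ 𝔸] in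
/-- a (3.46) block survives replacing its constant by `max B 0`. [cite: Balaban1985BackgroundPropagators, (3.46) p.398, bookkeeping] -/
theorem l2Block_max_zero {Bg : B9.Backgrounds} (K : B9.KernelFamily (geo9Y x) Bg) {B δ : ℝ} {c : Bg.Cfg}
    (h : L2Block K B δ c) : L2Block K (max B 0) δ c := by
  intro n lam hh y y' hc hs
  refine (h n lam hh y y' hc hs).trans ?_
  have h1 : 0 ≤ B9.pref6 ((geo9Y x).len y) n := pref6_nonneg (geo9Y_len_pos x y).le n
  have h2 : 0 ≤ (geo9Y x).cutSup hh := B9GeoNormsKLevelV1.geo9K_cutSup_nonneg x.toKIdx hh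
  have h3 : 0 ≤ (geo9Y x).l2Norm lam := B9GeoNormsKLevelV1.geo9K_l2Norm_nonneg x.toKIdx lam
  have h4 := (Real.exp_pos (-(δ * (geo9Y x).dist y y'))).le
  have h5 : B ≤ max B 0 := le_max_left _ _
  gcongr

end Member

/-! ## §2  ★★ On a subfamily: `hin` (positive input) and `hout` for `KSC₃` -/

section Chain

variable {J : Type} (f : J → MemberY d ℓ hd hL b₀ b₁ Mstar) [∀ x : MemberY d ℓ hd hL b₀ b₁ Mstar, Fintype (geo9Y x).Site]
  [∀ x : MemberY d ℓ hd hL b₀ b₁ Mstar, DecidableEq (geo9Y x).Site]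
  (G : Subgroup 𝔸ˣ) (par : ∀ j : J, SiteParY 𝔸 (f j).toKIdx) {ι : Type} [Fintype ι] [DecidableEq ι] (b : Module.Basis ι ℝ 𝔸)
  (ιB : ∀ j : J, BlkY (f j).toKIdx → IBondY (f j).toKIdx)
  (C37 C38 : ∀ j : J, ℝ → CfgY 𝔸 (f j).toKIdx → AfldY 𝔸 (f j).toKIdx → Prop)

omit [NormOneClass 𝔸] [∀ x : MemberY d ℓ hd hL b₀ b₁ Mstar, DecidableEq (geo9Y x).Site] in
/-- ★ **THE THRESHOLDS OF THE `L²` CONVERSIONS AT A POSITIVE RATE**: above `max (M261 δ₀) (4 log(ℓ+1)/(δ₀/12))` every member carries Lemma 2.1 of [4] at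
`(δ₀, 1/12)` (exponent `d261 δ₀`) and the scale transfers of `ℓ, ℓ², ℓ⁻¹, ℓ⁻²` with the constant `(ℓ+1)⁴`.
[cite: Balaban1984PropagatorsII, Lemma 2.1 (2.61) p.234; Balaban1985BackgroundPropagators, (3.47) p.398, bookkeeping] -/
theorem exists_thresholds_L2 : ∃ (d261 : ℝ → ℕ) (Mthr : ℝ → ℝ), ∀ (j : J) (δ₀ : ℝ), 0 < δ₀ → Mthr δ₀ ≤ (geo9Y (f j)).M →
    Ineq261 (d261 δ₀) (toB6 (geo9Y (f j)) (0 : ℝ) True) δ₀ (1 / 12) ∧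
      ScaleTransfer (geo9Y (f j)) δ₀ (1 / 12) (((ℓ : ℝ) + 1) ^ 4) (fun a => (geo9Y (f j)).len a) ∧
      ScaleTransfer (geo9Y (f j)) δ₀ (1 / 12) (((ℓ : ℝ) + 1) ^ 4) (fun a => (geo9Y (f j)).len a ^ 2) ∧
      ScaleTransfer (geo9Y (f j)) δ₀ (1 / 12) (((ℓ : ℝ) + 1) ^ 4) (fun a => ((geo9Y (f j)).len a)⁻¹) ∧
      ScaleTransfer (geo9Y (f j)) δ₀ (1 / 12) (((ℓ : ℝ) + 1) ^ 4) (fun a => ((geo9Y (f j)).len a)⁻¹ ^ 2) := by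
  obtain ⟨d261, M261, h261f⟩ := exists_d261 (d := d) (ℓ := ℓ) (hd := hd) (hL := hL) (b₀ := b₀) (b₁ := b₁) (Mstar := Mstar)
  refine ⟨d261, fun δ₀ => max (M261 δ₀) (4 * Real.log ((ℓ : ℝ) + 1) / (1 / 12 * δ₀)), fun j δ₀ hδ₀ hM => ?_⟩
  have hM1 : M261 δ₀ ≤ (geo9Y (f j)).M := le_trans (le_max_left _ _) hM
  have hM2 : 4 * Real.log ((ℓ : ℝ) + 1) / (1 / 12 * δ₀) ≤ (geo9Y (f j)).M := le_trans (le_max_right _ _) hM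
  have hκlo : 0 < 1 / 12 * δ₀ := by positivity
  have hST := scaleTransfer6_window_geo9Y hκlo (f j) (δ := δ₀) (α := 1 / 12) le_rfl hM2
  refine ⟨h261f (f j) δ₀ (1 / 12) hδ₀ (by norm_num) (by norm_num) hM1, hST.1, hST.2.1, hST.2.2.1, ?_⟩
  exact scaleTransfer_congr (fun y => by rw [inv_pow]) hST.2.2.2.1

omit [NormOneClass 𝔸] in
/-- ★★ **`hin` FOR `KSC₃` ON A SUBFAMILY, POSITIVE INPUT RATE**: for `0 < δ₀`, above the thresholds of `hin_KSC₂_on` and of the `L²` conversions, at every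
(3.35)-regular base the record family's Theorem-3.1–3.3 block (read along the decoding) gives `KSC₃`'s — the (3.42)–(3.45), (3.47) members by
`hin_KSC₂_on`, the augmented (3.46) member by `B9SectBL2SecondOrderY.l2Block_KSC₃_base_of_record` under the plaquette law of the regular bases
(`hplaq`, displayed: (3.35) ⇒ plaquette, `B9Eq335Plaquette`).  The arbitrary-sign input of `sectBStepPrinted_of_family` is NOT served here (Lemma 2.1 of
[4] needs `0 < δ₀`); the positive-input packaging (`B9SectBStepWhole.StepPos`) is the tree's route for that.
[cite: Balaban1985BackgroundPropagators, Thms 3.1–3.3 (3.42)–(3.48) pp.397–399, (3.35) p.396, p.398 (first remark), p.404 (after (3.69)); Balaban1984PropagatorsII, Lemma 2.1 p.234] -/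
theorem hin_KSC₃_on_pos (hι : ∀ (j : J) (s : BlkY (f j).toKIdx), β (f j).toKIdx.hN (f j).toKIdx.D (f j).toKIdx.hk (ιB j s) = s)
    (hG1 : ∀ u : 𝔸ˣ, u ∈ G → ‖(u : 𝔸)‖ ≤ 1) {M₂ : ℝ} (hM₂ : 0 ≤ M₂) (hrepr : ∀ (v : 𝔸) (j : ι), |b.repr v j| ≤ M₂ * ‖v‖) (c35 : ℝ) (dC : ℕ)
    (GA : ∀ j : J, B9.KernelFamily (geo9Y (f j)) (codingYx G (f j) (C37 j) (C38 j)).bg)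
    (Cinv : ∀ j : J, B9.SiteKernel (geo9Y (f j)) (codingYx G (f j) (C37 j) (C38 j)).bg)
    (hGA : ∀ (j : J) (c : (codingYx G (f j) (C37 j) (C38 j)).bg.Cfg),
      (∀ lam β' ζ, 0 ≤ (GA j).h1 c lam β' ζ) ∧ (∀ lam y, 0 ≤ (GA j).e4 c lam y) ∧ (∀ lam β' ζ, 0 ≤ (GA j).h2 c lam β' ζ))
    {cP : ℝ} (hcP : 0 ≤ cP)
    (hplaq : ∀ (j : J) (α₀ : ℝ) (U : CfgY 𝔸 (f j).toKIdx), (bg9Y 𝔸 G (f j)).Reg335 c35 α₀ U → PlaqLawY (f j) (ιB j) cP U) :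
    ∀ (B₀ δ₀ : ℝ) (Bβ Bε : ℝ → ℝ) (Bεβ : ℝ → ℝ → ℝ) (B₁ δ₁ : ℝ), 0 < δ₀ →
      ∃ (Mi ai B₀' δ₀' : ℝ) (Bβ' Bε' : ℝ → ℝ) (Bεβ' : ℝ → ℝ → ℝ) (B₁' δ₁' : ℝ), 0 < ai ∧
        ∀ j : J, Mi ≤ (geo9Y (f j)).M → ∀ α₀ : ℝ, 0 < α₀ → (geo9Y (f j)).M * α₀ ≤ ai →
          ∀ c : (codingYx G (f j) (C37 j) (C38 j)).bg.Cfg, (codingYx G (f j) (C37 j) (C38 j)).bg.Reg335 c35 α₀ c →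
          B9.Thms31to33IneqAt dC (pullK (codingYx G (f j) (C37 j) (C38 j))
              (kernelFamilyS (f j).toKIdx (bg9Y 𝔸 G (f j)) (fun U => U) (GpY (f j).toKIdx (par j)) (par j))) (GA j) (Cinv j) B₀ δ₀ Bβ Bε Bεβ B₁ δ₁ c →
          B9.Thms31to33IneqAt dC (KSC₃ G (f j) (par j) (C37 j) (C38 j)) (GA j) (Cinv j) B₀' δ₀' Bβ' Bε' Bεβ' B₁' δ₁' c := by
  intro B₀ δ₀ Bβ Bε Bεβ B₁ δ₁ hδ₀
  obtain ⟨Mi, ai, B₀', δ₀', Bβ', Bε', Bεβ', B₁', δ₁', hai, H⟩ :=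
    hin_KSC₂_on f G par b ιB C37 C38 hι hG1 hM₂ hrepr c35 dC GA Cinv B₀ δ₀ Bβ Bε Bεβ B₁ δ₁
  obtain ⟨d261, Mthr, hthr⟩ := exists_thresholds_L2 f
  set Sb : ℝ := ∑ j, ‖b j‖ with hSb
  set sι : ℝ := Real.sqrt (Fintype.card ι) with hsι
  set Λ : ℝ := ((ℓ : ℝ) + 1) ^ 4 with hΛ
  set BL : ℝ := (sι * M₂ * Sb) * max (crossConstL2 M₂ Sb sι d (d261 δ₀) δ₀ Λ (max B₀ 0)) (cross2ConstL2 cP M₂ Sb sι d (d261 δ₀) δ₀ Λ (max B₀ 0))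
    with hBL
  have hΛ1 : 1 ≤ Λ := one_le_pow₀ (by linarith [(Nat.cast_nonneg ℓ : (0 : ℝ) ≤ ℓ)])
  have hSb0 : 0 ≤ Sb := Finset.sum_nonneg fun j _ => norm_nonneg _
  have hsι0 : 0 ≤ sι := Real.sqrt_nonneg _
  have hBL0 : 0 ≤ BL := by
    have := crossConstL2_nonneg hM₂ hSb0 hsι0 d (d261 δ₀) δ₀ Λ (le_max_right B₀ 0)
    rw [hBL]; exact mul_nonneg (by positivity) (le_max_of_le_left this)
  refine ⟨max Mi (Mthr δ₀), ai, max (max B₀' 0) BL, min δ₀' (δ₀ / 2), Bβ', Bε', Bεβ', B₁', δ₁', hai, fun j hM α₀ hα₀ hMa c hreg hT => ?_⟩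
  · have hMi : Mi ≤ (geo9Y (f j)).M := le_trans (le_max_left _ _) hM
    have hMt : Mthr δ₀ ≤ (geo9Y (f j)).M := le_trans (le_max_right _ _) hM
    obtain ⟨h261, hT1, -, -, hTi2⟩ := hthr j δ₀ hδ₀ hMt
    -- the other members: `hin_KSC₂_on`
    have hK2 := H j hMi α₀ hα₀ hMa c hreg hT
    obtain ⟨U, rfl, hU335⟩ := (codingYx G (f j) (C37 j) (C38 j)).exists_of_bg_Reg335 hreg
    have hU : GVal G (f j).toKIdx U := hU335.1.1
    -- the record's (3.46) block at `U`, read off `hT` along the decoding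
    have hL2 : L2Block (kernelFamilyS (f j).toKIdx (bg9Y 𝔸 G (f j)) (fun U => U) (GpY (f j).toKIdx (par j)) (par j)) (max B₀ 0) δ₀ U := by
      refine l2Block_max_zero (f j) _ fun n lam hh y y' hc hs => ?_
      have h := hT.1.1.2.1 n lam hh y y' hc hs
      exact h
    have hK3 := l2Block_KSC₃_base_of_record G (f j) (par j) b (ιB j) (C37 j) (C38 j) (hι j) hG1 hM₂ hrepr hδ₀ h261 hΛ1 hT1 hTi2 hcP (le_max_right B₀ 0)
      hU (hplaq j α₀ U hU335) hL2
    have hK2' := thms_mono_B₀ G (f j) (C37 j) (C38 j) dC _ (GA j) (Cinv j) (le_max_left B₀' 0) hK2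
    have h := thms_KSC₃_base_of_KSC₂ G (f j) (par j) (C37 j) (C38 j) dC (GA j) (Cinv j) (le_max_right B₀' 0) (hGA j _).1 (hGA j _).2.1 (hGA j _).2.2
      hK2' hBL0 (by rw [hBL, hSb, hsι]; exact hK3)
    exact h

/-- ★★ **`hout` FOR `KSC₃` ON A SUBFAMILY**: `KSC₃`'s Theorem-3.1–3.3 block at the product ⟹ (the (3.46) member converted to the record's at `W = U′U` by
`B9SectBL2SecondOrderY.l2Block_record_at_W_of_KSC₃'`, under the plaquette law of the regular base, `hplaq`) `KSC₂`'s block at the product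
(`thms_KSC₂_prod_of_KSC₃`) ⟹ the record family's block read along the decoding (`hout_KSC₂_on`).  Thresholds `max Mo (Mthr δ₀)`, caps `ao`,
`a′ ≦ min a (1/4)`, constants those of `hout_KSC₂_on` at the input `(max B₀ (c_L·convConst2L2), min δ₀ (δ₀/2))`.
[cite: Balaban1985BackgroundPropagators, Thm 3.4 p.400, p.403 l.1–9, (3.46) p.398, (3.47) p.398, p.404 (after (3.69)); Balaban1984PropagatorsII, Lemma 2.1 p.234] -/
theorem hout_KSC₃_on (hG1 : ∀ u : 𝔸ˣ, u ∈ G → ‖(u : 𝔸)‖ ≤ 1) {M₂ : ℝ} (hM₂ : 0 ≤ M₂) (hrepr : ∀ (v : 𝔸) (j : ι), |b.repr v j| ≤ M₂ * ‖v‖)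
    (hι : ∀ (j : J) (s : BlkY (f j).toKIdx), β (f j).toKIdx.hN (f j).toKIdx.D (f j).toKIdx.hk (ιB j s) = s)
    {Cq : ℝ} (hC37 : ∀ j β' U a, C37 j β' U a → GVal G (f j).toKIdx U ∧ CplxLettersY G (f j) (par j) (ιB j) Cq β' U a) (c35 : ℝ) (dC : ℕ)
    (GA : ∀ j : J, B9.KernelFamily (geo9Y (f j)) (codingYx G (f j) (C37 j) (C38 j)).bg)
    (Cinv : ∀ j : J, B9.SiteKernel (geo9Y (f j)) (codingYx G (f j) (C37 j) (C38 j)).bg)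
    (hGA : ∀ (j : J) (c : (codingYx G (f j) (C37 j) (C38 j)).bg.Cfg),
      (∀ lam β' ζ, 0 ≤ (GA j).h1 c lam β' ζ) ∧ (∀ lam y, 0 ≤ (GA j).e4 c lam y) ∧ (∀ lam β' ζ, 0 ≤ (GA j).h2 c lam β' ζ))
    {cP : ℝ} (hcP : 0 ≤ cP)
    (hplaq : ∀ (j : J) (α₀ : ℝ) (U : CfgY 𝔸 (f j).toKIdx), (bg9Y 𝔸 G (f j)).Reg335 c35 α₀ U → PlaqLawY (f j) (ιB j) cP U) :
    ∀ (B₀ δ₀ : ℝ) (Bβ Bε : ℝ → ℝ) (Bεβ : ℝ → ℝ → ℝ) (B₁ δ₁ : ℝ) (acap : ℝ), 0 < B₀ → 0 < δ₀ → 0 < B₁ → 0 < δ₁ → 0 < acap →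
      ∃ (Mo ao a' B₀' δ₀' : ℝ) (Bβ' Bε' : ℝ → ℝ) (Bεβ' : ℝ → ℝ → ℝ) (B₁' δ₁' : ℝ),
        0 < ao ∧ 0 < a' ∧ a' ≤ acap ∧ 0 < B₀' ∧ 0 < δ₀' ∧ 0 < B₁' ∧ 0 < δ₁' ∧
        ∀ j : J, Mo ≤ (geo9Y (f j)).M → ∀ α₀ : ℝ, 0 < α₀ → (geo9Y (f j)).M * α₀ ≤ ao →
          ∀ c : (codingYx G (f j) (C37 j) (C38 j)).bg.Cfg, (codingYx G (f j) (C37 j) (C38 j)).bg.Reg335 c35 α₀ c →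
          ∀ α₁ : ℝ, 0 < α₁ → α₁ ≤ a' → ∀ c' : (codingYx G (f j) (C37 j) (C38 j)).bg.Cfg, (codingYx G (f j) (C37 j) (C38 j)).bg.Cplx337 α₁ c c' →
          B9.Thms31to33IneqAt dC (KSC₃ G (f j) (par j) (C37 j) (C38 j)) (GA j) (Cinv j) B₀ δ₀ Bβ Bε Bεβ B₁ δ₁
              ((codingYx G (f j) (C37 j) (C38 j)).bg.mul c' c) →
          B9.Thms31to33IneqAt dC (pullK (codingYx G (f j) (C37 j) (C38 j))
              (kernelFamilyS (f j).toKIdx (bg9Y 𝔸 G (f j)) (fun U => U) (GpY (f j).toKIdx (par j)) (par j))) (GA j) (Cinv j)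
              B₀' δ₀' Bβ' Bε' Bεβ' B₁' δ₁' ((codingYx G (f j) (C37 j) (C38 j)).bg.mul c' c) := by
  intro B₀ δ₀ Bβ Bε Bεβ B₁ δ₁ acap hB₀ hδ₀ hB₁ hδ₁ hacap
  obtain ⟨d261, Mthr, hthr⟩ := exists_thresholds_L2 f
  set Sb : ℝ := ∑ j, ‖b j‖ with hSb
  set sι : ℝ := Real.sqrt (Fintype.card ι) with hsι
  set Λ : ℝ := ((ℓ : ℝ) + 1) ^ 4 with hΛ
  set B'' : ℝ := (sι * M₂ * Sb) * convConst2L2 cP M₂ Sb sι d (d261 δ₀) δ₀ Λ B₀ with hB''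
  have hΛ0 : 0 ≤ Λ := by positivity
  have hSb0 : 0 ≤ Sb := Finset.sum_nonneg fun j _ => norm_nonneg _
  have hsι0 : 0 ≤ sι := Real.sqrt_nonneg _
  have hB''0 : 0 ≤ B'' := by
    have := (convConst2L2_nonneg (dL := d261 δ₀) (δ₀ := δ₀) hcP hM₂ hSb0 hsι0 d hΛ0 hB₀.le).2.2.2
    rw [hB'']; exact mul_nonneg (by positivity) this
  obtain ⟨Mo, ao, a', B₀', δ₀', Bβ', Bε', Bεβ', B₁', δ₁', hao, ha', ha'a, hB₀', hδ₀', hB₁', hδ₁', H⟩ :=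
    hout_KSC₂_on f G par b ιB C37 C38 hG1 hM₂ hrepr hι hC37 c35 dC GA Cinv hGA (max B₀ B'') (min δ₀ (δ₀ / 2)) Bβ Bε Bεβ B₁ δ₁ (min acap (1 / 4))
      (lt_max_of_lt_left hB₀) (lt_min hδ₀ (half_pos hδ₀)) hB₁ hδ₁ (lt_min hacap (by norm_num))
  refine ⟨max Mo (Mthr δ₀), ao, a', B₀', δ₀', Bβ', Bε', Bεβ', B₁', δ₁', hao, ha', ha'a.trans (min_le_left _ _), hB₀', hδ₀', hB₁', hδ₁',
    fun j hM α₀ hα₀ hMa c hreg α₁ hα₁ hα₁a c' h37 hT => ?_⟩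
  have hMo : Mo ≤ (geo9Y (f j)).M := le_trans (le_max_left _ _) hM
  have hMt : Mthr δ₀ ≤ (geo9Y (f j)).M := le_trans (le_max_right _ _) hM
  obtain ⟨h261, hT1, hT2, hTi, hTi2⟩ := hthr j δ₀ hδ₀ hMt
  obtain ⟨U, a, rfl, rfl, hC⟩ := (codingYx G (f j) (C37 j) (C38 j)).exists_of_bg_Cplx337 h37
  have hα₁c : α₁ ≤ 1 / 4 := hα₁a.trans (ha'a.trans (min_le_right _ _))
  have hU335 : (bg9Y 𝔸 G (f j)).Reg335 c35 α₀ U := hreg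
  -- the (3.46) member of `KSC₃` at the product, then the record's (3.46) block at `W`
  have hL2 : L2Block (KSC₃ G (f j) (par j) (C37 j) (C38 j)) B₀ δ₀ (.prod U a) := fun n lam hh y y' hc hs => hT.1.1.2.1 n lam hh y y' hc hs
  have hconv := l2Block_record_at_W_of_KSC₃' G (f j) (par j) b (ιB j) (C37 j) (C38 j) (hι j) hG1 hM₂ hrepr (hC37 j) hδ₀ h261 hΛ0 hT1 hT2 hTi hTi2
    hcP hB₀.le hα₁c hC (hplaq j α₀ U hU335) hL2
  -- `KSC₂`'s block at the product, then the record family's along the decoding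
  have hK2 := thms_KSC₂_prod_of_KSC₃ G (f j) (par j) (C37 j) (C38 j) dC (GA j) (Cinv j) hB₀.le (hGA j _).1 (hGA j _).2.1 (hGA j _).2.2 hT hB''0
    (by rw [hB'', hSb, hsι]; exact hconv)
  exact H j hMo α₀ hα₀ hMa _ hreg α₁ hα₁ hα₁a _ h37 hK2

/-- ★★ **THE CODED-CARRIER CHAIN FOR `KSC₃` ON A SUBFAMILY** (as `B9SectBCodedChainGlob.sectBStepPrinted_on_of_KSC₂`, through the positive-input family
transfer `sectBStepPrinted_of_family_pos` with `hin_KSC₃_on_pos` and `hout_KSC₃_on`).  Displayed: the plaquette law of the regular bases (`hplaq`), the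
record's Theorem-3.1–3.3 blocks at the regular bases with some positive constants (`hThms`, print p. 407 «assuming that Theorems 3.1–3.3 hold»), and
the Sect.-B step of the frames for `KSC₃` (`h`).
[cite: Balaban1985BackgroundPropagators, Thm 3.4 p.400, Sect. B pp.400–407, p.403 l.1–9, p.407, (3.35)–(3.37) p.396, (3.46)–(3.47) p.398] -/
theorem sectBStepPrinted_on_of_KSC₃ (hG1 : ∀ u : 𝔸ˣ, u ∈ G → ‖(u : 𝔸)‖ ≤ 1) {M₂ : ℝ} (hM₂ : 0 ≤ M₂)
    (hrepr : ∀ (v : 𝔸) (j : ι), |b.repr v j| ≤ M₂ * ‖v‖)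
    (hι : ∀ (j : J) (s : BlkY (f j).toKIdx), β (f j).toKIdx.hN (f j).toKIdx.D (f j).toKIdx.hk (ιB j s) = s)
    {Cq : ℝ} (hC37 : ∀ j β' U a, C37 j β' U a → GVal G (f j).toKIdx U ∧ CplxLettersY G (f j) (par j) (ιB j) Cq β' U a) (c35 : ℝ) (dC : ℕ)
    (GA : ∀ j : J, B9.KernelFamily (geo9Y (f j)) (bg9Y 𝔸 G (f j))) (Cinv : ∀ j : J, B9.SiteKernel (geo9Y (f j)) (bg9Y 𝔸 G (f j)))
    (hGA : ∀ (j : J) (U : (bg9Y 𝔸 G (f j)).Cfg),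
      (∀ lam β' ζ, 0 ≤ (GA j).h1 U lam β' ζ) ∧ (∀ lam y, 0 ≤ (GA j).e4 U lam y) ∧ (∀ lam β' ζ, 0 ≤ (GA j).h2 U lam β' ζ))
    {cP : ℝ} (hcP : 0 ≤ cP)
    (hplaq : ∀ (j : J) (α₀ : ℝ) (U : CfgY 𝔸 (f j).toKIdx), (bg9Y 𝔸 G (f j)).Reg335 c35 α₀ U → PlaqLawY (f j) (ιB j) cP U)
    (IsAnK : ∀ j : J, B9.KernelFamily (geo9Y (f j)) (codingYx G (f j) (C37 j) (C38 j)).bg → (codingYx G (f j) (C37 j) (C38 j)).bg.Cfg → ℝ → Prop)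
    (IsAn : ∀ j : J, B9.KernelFamily (geo9Y (f j)) (bg9Y 𝔸 G (f j)) → (bg9Y 𝔸 G (f j)).Cfg → ℝ → Prop)
    {r αcap Mc ac : ℝ} (hr : 0 < r) (hcap : 0 < αcap) (hac : 0 < ac)
    (hAn : ∀ (j : J) (c : (codingYx G (f j) (C37 j) (C38 j)).bg.Cfg) (α : ℝ),
      (IsAnK j (KSC₃ G (f j) (par j) (C37 j) (C38 j)) c α →
        pullAn (codingYx G (f j) (C37 j) (C38 j)) r (IsAn j)
          (pullK (codingYx G (f j) (C37 j) (C38 j)) (kernelFamilyS (f j).toKIdx (bg9Y 𝔸 G (f j)) (fun U => U) (GpY (f j).toKIdx (par j)) (par j))) c α) ∧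
      (IsAnK j (pullK (codingYx G (f j) (C37 j) (C38 j)) (GA j)) c α →
        pullAn (codingYx G (f j) (C37 j) (C38 j)) r (IsAn j) (pullK (codingYx G (f j) (C37 j) (C38 j)) (GA j)) c α))
    (hclass : ∀ (j : J) (α₀ α₁ : ℝ) (U U' : (bg9Y 𝔸 G (f j)).Cfg), Mc ≤ (geo9Y (f j)).M → 0 < α₀ → (geo9Y (f j)).M * α₀ ≤ ac →
      (bg9Y 𝔸 G (f j)).Reg335 c35 α₀ U → 0 < α₁ → α₁ ≤ αcap → (bg9Y 𝔸 G (f j)).Cplx337 α₁ U U' →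
      ∃ a : (codingYx G (f j) (C37 j) (C38 j)).A,
        (codingYx G (f j) (C37 j) (C38 j)).decA a = U' ∧ (codingYx G (f j) (C37 j) (C38 j)).C37 (r * α₁) U a)
    (hThms : ∃ (Mt aT B₀ δ₀ : ℝ) (Bβ Bε : ℝ → ℝ) (Bεβ : ℝ → ℝ → ℝ) (B₁ δ₁ : ℝ), 0 < aT ∧ 0 < δ₀ ∧
      ∀ j : J, Mt ≤ (geo9Y (f j)).M → ∀ α₀ : ℝ, 0 < α₀ → (geo9Y (f j)).M * α₀ ≤ aT →
        ∀ c : (codingYx G (f j) (C37 j) (C38 j)).bg.Cfg, (codingYx G (f j) (C37 j) (C38 j)).bg.Reg335 c35 α₀ c →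
        B9.Thms31to33IneqAt dC (pullK (codingYx G (f j) (C37 j) (C38 j))
            (kernelFamilyS (f j).toKIdx (bg9Y 𝔸 G (f j)) (fun U => U) (GpY (f j).toKIdx (par j)) (par j)))
          (pullK (codingYx G (f j) (C37 j) (C38 j)) (GA j)) (pullS (codingYx G (f j) (C37 j) (C38 j)) (Cinv j)) B₀ δ₀ Bβ Bε Bεβ B₁ δ₁ c)
    (h : B9.SectBStepPrinted dC c35 (fun j => geo9Y (f j)) (fun j => (codingYx G (f j) (C37 j) (C38 j)).bg)
      (fun j => KSC₃ G (f j) (par j) (C37 j) (C38 j)) (fun j => pullK (codingYx G (f j) (C37 j) (C38 j)) (GA j))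
      (fun j => pullS (codingYx G (f j) (C37 j) (C38 j)) (Cinv j)) IsAnK) :
    B9.SectBStepPrinted dC c35 (fun j => geo9Y (f j)) (fun j => bg9Y 𝔸 G (f j))
      (fun j => kernelFamilyS (f j).toKIdx (bg9Y 𝔸 G (f j)) (fun U => U) (GpY (f j).toKIdx (par j)) (par j)) GA Cinv IsAn := by
  have hGA' : ∀ (j : J) (c : (codingYx G (f j) (C37 j) (C38 j)).bg.Cfg),
      (∀ lam β' ζ, 0 ≤ (pullK (codingYx G (f j) (C37 j) (C38 j)) (GA j)).h1 c lam β' ζ) ∧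
      (∀ lam y, 0 ≤ (pullK (codingYx G (f j) (C37 j) (C38 j)) (GA j)).e4 c lam y) ∧
      (∀ lam β' ζ, 0 ≤ (pullK (codingYx G (f j) (C37 j) (C38 j)) (GA j)).h2 c lam β' ζ) := fun j c => hGA j _
  refine sectBStepPrinted_of_coded dC c35 (fun j => geo9Y (f j)) (fun j => bg9Y 𝔸 G (f j)) (fun j => codingYx G (f j) (C37 j) (C38 j))
    (fun j => kernelFamilyS (f j).toKIdx (bg9Y 𝔸 G (f j)) (fun U => U) (GpY (f j).toKIdx (par j)) (par j)) GA Cinv IsAn hr hcap hac hclass ?_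
  exact sectBStepPrinted_of_family_pos dC c35 (fun j => geo9Y (f j)) (fun j => (codingYx G (f j) (C37 j) (C38 j)).bg)
    (fun j => KSC₃ G (f j) (par j) (C37 j) (C38 j))
    (fun j => pullK (codingYx G (f j) (C37 j) (C38 j)) (kernelFamilyS (f j).toKIdx (bg9Y 𝔸 G (f j)) (fun U => U) (GpY (f j).toKIdx (par j)) (par j)))
    (fun j => pullK (codingYx G (f j) (C37 j) (C38 j)) (GA j)) (fun j => pullK (codingYx G (f j) (C37 j) (C38 j)) (GA j))
    (fun j => pullS (codingYx G (f j) (C37 j) (C38 j)) (Cinv j)) IsAnK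
    (fun j => pullAn (codingYx G (f j) (C37 j) (C38 j)) r (IsAn j)) hThms
    (fun B₀ δ₀ Bβ Bε Bεβ B₁ δ₁ hδ₀ => hin_KSC₃_on_pos f G par b ιB C37 C38 hι hG1 hM₂ hrepr c35 dC _ _ hGA' hcP hplaq B₀ δ₀ Bβ Bε Bεβ B₁ δ₁ hδ₀)
    (hout_KSC₃_on f G par b ιB C37 C38 hG1 hM₂ hrepr hι hC37 c35 dC _ _ hGA' hcP hplaq) hAn h

end Chain

end Literature.MathematicalPhysics.QuantumFieldTheory.Balaban1983to89.B9SectBCodedChainL2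

end
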